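import Summits.QuantumFields.YangMills.Theorems.BalabanUVNodesN17Knit
import Summits.QuantumFields.BalabanUV.T4Continuum.Support.NE4TransferResolventWitness

/-!
# BalabanUVNodes ∕ N17 KNIT, companion 3 (§10–§12) — the node's TITLE road «β⁰ conv + β¹ shift + fading memory»: N17 from
# (AF-0r) and the ONE-STEP TRANSFER MODEL of Bałaban's renormalization transformation (rows NE2∕NE3 = N15∕N16 as the one-step
# η-SOURCE, (B) as admissibility, fading memory DERIVED), the N17 → N27 edge on this road WITHOUT the asymptotic-freedom binder,
# and non-vacuity by the tree's toy

TRACK A (YM-PLAN v0.12.16 §2c row NE4, node N17 of 28; HUMAN RULING D-0062), seat `pub-ymgap-dag-n17-a` gen 2 (-a KNIT-BY-NAME).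
Companion of `BalabanUVNodesN17Knit` (p408968; §§1–6) and `BalabanUVNodesN17KnitEdge` (p409440 → p410452; §§7–9).  THEOREMS ONLY:
def-free, sorry-free, standard axioms.  EVERYTHING MATHEMATICAL BELOW IS AN EXISTING KERNEL THEOREM OF THE TREE USED BY NAME; this file
is the referee-facing assembly of ONE MORE typed road into `Spine.NE4.NE4OnData` that files 1–2 did not knit.  It proves no estimate
of Bałaban's and moves no count.

## THE ROAD (YM-PLAN row NE4's own words «η-rate of the full β_k = ScaleShiftRate (β⁰ conv + β¹ shift + fading memory)»).
Files 1–2 reach N17 either through node U3 (N18 = NE5 b-family + (D4) read-out, N22 idle) or through the printed one-loop split with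
the remainder's rate `RemainderShiftRate` as a free binder (§2).  The tree ALSO derives that binder: the RESOLVENT ∕ GENERATING-FUNCTION
route of `Support/NE4TransferModel` + `Support/NE4TransferResolvent` (cell `pub-balaban`, lineage `b2b-balaban-t4-ne4-p3`) types ONE
application of Bałaban's transformation as a normed one-step transfer model `M : StepTransferModel 𝔅 𝔸` (linear old-term transfer
`W` = [Balaban1988RG2Cluster] Lemma 1 (1.33), activity → bracket `N` = (2.13) + §2, activity → remainder read-out `r` = (1.20)∕(1.22),
stored brackets `B` = (0.23)) with SEVEN ONE-STEP LEAVES, each over ONE step and ONE history (hypothesis shapes, asserted by nobody):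
`Represents`, `ReadsRemainder` (identifications), `TransferBound C_W ω` (PRINTED TYPE: [II] Lemma 1 (1.36) p. 9 with the age factor
of p. 8), `ActivityLipschitz C_F C_r` (PRINTED TYPE: [II] (2.14) p. 15, Lemma 3 (2.38) p. 20), `CouplingLipschitz ℓ′ ℓ` (qualitative in
print, [I] p. 264), `Admissible E₀` (= (B) for the small-field flow BY TYPE, [I] Thm 3 p. 264 — the K1–K3 clusters' END statement in
this currency), and `StepScaleShift b b_r ρ` — THE ONE-STEP η-SOURCE: «the η-dependence of the one-step DATA — covariances∕propagators
(NE2, `T4EtaRate`), minimisers (NE3, `T4EtaRateMin`), the O(η²) Wilson vertices — read through the step» (the module's docstring): THIS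
is where YM-PLAN's in-edges «NE2, NE3» = nodes N15, N16 enter N17 on this road, BY NAME and NOT PRINTED.  The kernel then PRODUCES
(Neumann series of the age-weighted shift, `T4BetaMemorySharp.renewal_le`): `RemainderShiftRate S (shiftConst …) θ γ`
(`remainderShiftRate_of_model`) for every rate `θ ∈ ]ν, 1]`, `θ ≥ ρ`, `ν = ω + C_F·C_W` (the window «O(1)C₃ε₁ ≤ ½E₀» of [II] p. 21
by TYPE), and node U2's WHOLE TRIPLE `ScaleShiftRate ∧ HistLipschitz ∧ FadingMemory` (`ne4Triple_of_model`) with memory rate EXACTLY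
`ν` — the fading memory that N22 (NE9 ∧ fading memory on U3's carriers) supplies on road U3 is DERIVED here, not borrowed.

## WHAT §10–§12 ADD (by name)
§10 `N17_of_transferModel`: N17 = `NE4OnData D (2c₀ + shiftConst …) θ γ` ⇐ (AF-0r) `hconv` ∧ the seven leaves ∧ signs ∧ the window —
`N17_of_split` ∘ `remainderShiftRate_of_model`; `N17_of_kernelInputs_transferModel`: the same with (AF-0r) SUPPLIED in N15's
currency `Beta.LimitRate.KernelInputs` (k-uniform kernel decay (5.10) + convergence with a rate of the LINEAR theory,
`Beta.LimitRate.limitSplit_of_kernelInputs`) — so BOTH halves of the title come from rows NE2∕NE3's currencies: «β⁰ conv» from N15's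
kernel rate, «β¹ shift + fading memory» from the one-step η-source; `u2Inputs_of_transferModel`: node U2's whole input triple
`Spine.NE4.U2Inputs` at ONE rate (memory rate worsened `ν ↦ θ`, `T4FlagMemory.fadingMemory_mono`).
§11 THE N17 → N27 EDGE ON THIS ROAD NEEDS NO ASYMPTOTIC-FREEDOM BINDER: `u2Output_of_N17_gap` ∕ `u2Output_under_of_N17_gap` — the
AF-FREE twins of `Spine.NE4.Targets.u2Output_of_u2Inputs` ∕ `u2Output_under`: N17 + history moduli with fading memory at a rate `ν`
STRICTLY BELOW the shift rate `θ` + the printed-type upper bound `BetaUpperH β′` with `γ²β′ < 1` (only to run (0.20) forward for tuned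
sequences, `T4TwoRunUniqueness.rgEqH_of_tuned`) give node U2's output `U2Output D g₀ (2c∕(1−θ)) θ` (under the targets' prefix: for every
small box, the γ³-window `C·(γ³∕2)·θ∕(θ−ν) ≤ (1−θ)∕2` being met by `γ` small, `gapWindow_of_small_box`) —
`T4CurrencyMatching.injectedRate_of_runs_gap` BY NAME («the eventual lower bound is traded for the memory gap»).  Hence
`u2Output_under_of_transferModel`: N17 → N27 END TO END from the one-step leaves + (AF-0r) + (U) — NO N18, NO N22, NO (D4) read-out
binder, NO `EventualLowerH`, NO window binder (on THIS road the gap `ν < θ` is free).  CENSUS CONSEQUENCE FOR EVERY ROAD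
(`u2Output_under_of_u2Inputs_gap`, `u2Output_under_of_u3edge_gap`): node U2's input triple at ONE joint rate `ρ` (file 1's road U3,
`u2Inputs_of_u3edge`) ALSO gives node U2's output AF-free at any STRICTLY WORSE output rate `ρ′ ∈ ]ρ,1[` — files 1–2 kept the output rate
EQUAL to `ρ`, and that equality is the only place where `EventualLowerH b γ k₀` at strict grade `b > 0` (YM-PLAN row n17's third in-edge
«(D4) at strict grade», `Beta.CouplingMatchingCarrier.slope_zero_not_enough_T4` = pv16's summable-weights road) was load-bearing on the
N17 → N27 edge.  (Elsewhere — the END node N25 ∕ [B12] Thm 2's endpoint half, the limit flow `b*_m ≥ b` of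
`Spine.NE4.Targets.continuumRunning_of_u2Output` — the AF grades keep their roles; not this file's business.  The rate loss is harmless
downstream as long as `ρ′` stays below the transport rate of `Spine.NE4.TransportDominatesRate`.)
§12 NON-VACUITY AND CONTRAST: `N17_of_toyBeta` — at any datum whose β-family is the tree's toy `NE4TransferResolventWitness.toyBeta`
(a genuinely HISTORY-DEPENDENT family, `toyBeta_depends_on_history`, whose memory rate `ν` is ATTAINED, `toy_not_fadingMemory_below`)
N17 HOLDS at every rate `θ ∈ ]ν, 1]` (`toy_ne4Triple`); file 1 §6: at a datum with the history-FREE oscillating family N17 FAILS at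
every `θ < 1`.  The node's content is exactly the fading of the history dependence — the title's third word.

## HONEST FRAMING.  IS: kernel bookkeeping BY NAME at an ARBITRARY finite-ε datum `D` (hence at any datum of record by instantiation).
IS NOT: a proof of NE4 for Bałaban's β-functions — every leaf of `M` is a BINDER discharged by nobody; no tree arrow produces
`StepScaleShift` from N15's record decls (`T4EtaRate.NE2PlusOperator` …) or N16's (`NE3EnergyWeightedCovShape.NE3EnergyRateWCov`) —
that instancing («the swarm's work: file 1's DICTIONARY») is the located typed gap of this road; (AF-0r) is GAPS G-an2-4; NE4 is NOT
PRINTED ([Balaban1987RG1] p. 264 «We will investigate other properties in a separate paper») and DEPENDENT (BALABAN-GAPS v1.0 §C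
l.50); count-neutral; one finite four-torus at fixed ε — NOT ℝ⁴, NOT infinite volume, NOT OS, NOT a mass gap, NOT Clay.
References (TYPES and locators only): [Balaban1987RG1] = T. Bałaban, CMP **109** (1987): (0.20) p. 256, (0.23) p. 256, Thm 2 p. 259,
(1.20)–(1.22) p. 264, Thm 3 p. 264, (2.12)–(2.14) p. 268, (5.10) p. 293; [Balaban1988RG2Cluster] = CMP **116** (1988): Lemma 1
(1.33)–(1.36) pp. 8–9, (2.14) p. 15, Lemma 3 (2.38) p. 20, p. 21.
-/

noncomputable section

namespace Summit.QuantumFields.YangMills.Theorems.BalabanUVNodesN17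

open Literature.MathematicalPhysics.QuantumFieldTheory.Balaban1983to89
open Literature.MathematicalPhysics.QuantumFieldTheory.Balaban1983to89.FlowStep
open Literature.MathematicalPhysics.QuantumFieldTheory.Balaban1983to89.T4CouplingMatching
open Literature.MathematicalPhysics.QuantumFieldTheory.Balaban1983to89.T4Continuum
open Literature.MathematicalPhysics.QuantumFieldTheory.Balaban1983to89.T4TwoRunUniqueness (rgEqH_of_tuned)
open Literature.MathematicalPhysics.QuantumFieldTheory.Balaban1983to89.T4FlagMemory (fadingMemory_mono)
open Literature.MathematicalPhysics.QuantumFieldTheory.Balaban1983to89.T4CurrencyMatching (injectedRate_of_runs_gap)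
open Summit.QuantumFields.BalabanUV.T4Continuum.Spine
open Summit.QuantumFields.BalabanUV.T4Continuum.Spine.NE4 (NE4OnData U2Inputs U2Output runFlow box_and_pin_of_tuned)
open Summit.QuantumFields.BalabanUV.T4Continuum.NE4TransferModel (StepTransferModel moduli)
open Summit.QuantumFields.BalabanUV.T4Continuum.NE4TransferResolvent
  (shiftConst shiftConst_nonneg remainderShiftRate_of_model ne4Triple_of_model)
open Summit.QuantumFields.BalabanUV.T4Continuum.NE4TransferResolventWitness (toyBeta toy_ne4Triple)

universe u

variable {F : T4Family} {G : Type u} [GaugeGroup G] [MeasurableSpace G] [HaarData G]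
variable {𝔅 𝔸 : Type*} [NormedAddCommGroup 𝔅] [NormedSpace ℝ 𝔅] [NormedAddCommGroup 𝔸] [NormedSpace ℝ 𝔸]

/-! ## §10 ROAD ONE-STEP TRANSFER — «β⁰ conv + β¹ shift + fading memory»: N17 from (AF-0r) and the one-step leaves -/

section Transfer

/-- **N17 ⇐ (AF-0r) ∧ THE ONE-STEP TRANSFER MODEL (kernel, by name).**  At Bałaban's datum `D`, let the remainder of the PRINTED
one-loop split `S` of `D.βfun` ([Balaban1987RG1] (2.12)–(2.14) p. 268) be read off a one-step transfer model `M` (`Represents`,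
`ReadsRemainder`) whose leaves hold on the window `]0,γ]`: the age-weighted transfer bound `TransferBound C_W ω` (PRINTED TYPE, [II]
Lemma 1 (1.36)), activity → value Lipschitz `ActivityLipschitz C_F C_r` (PRINTED TYPE, [II] (2.14)∕(2.38)), admissibility `Admissible E₀`
(= (B) BY TYPE, [I] Thm 3), and the ONE-STEP η-SOURCE `StepScaleShift b b_r ρ` (rows NE2∕NE3 = nodes N15∕N16 read through the step —
NOT PRINTED); signs; the window `ν = ω + C_F·C_W < θ`, `ρ ≤ θ ≤ 1`.  With (AF-0r) `|β⁰_{k+1} − β⁰_∞| ≤ c₀θ^k` (GAPS G-an2-4, binder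
`hconv`): `NE4OnData D (2c₀ + shiftConst b b_r C_F C_r C_W E₀ ω θ) θ γ` — file 1's `N17_of_split` fed by
`NE4TransferResolvent.remainderShiftRate_of_model`.  Every leaf a BINDER. [cite: Balaban1987RG1, (2.12)-(2.14) p.268; Balaban1988RG2Cluster, Lemma 1 (1.33)-(1.36) p.9] -/
theorem N17_of_transferModel (D : FiniteEpsData F G) (S : B12Beta.OneLoopSplit D.βfun) (M : StepTransferModel 𝔅 𝔸)
    {γ C_W ω C_F C_r E₀ b b_r ρ θ binf c₀ : ℝ} (hRep : M.Represents γ) (hRead : M.ReadsRemainder S γ)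
    (hT : M.TransferBound C_W ω γ) (hA : M.ActivityLipschitz C_F C_r E₀ γ) (hAdm : M.Admissible E₀ γ)
    (hS : M.StepScaleShift b b_r ρ E₀ γ) (hCF : 0 ≤ C_F) (hCr : 0 ≤ C_r) (hCW : 0 ≤ C_W) (hE₀ : 0 ≤ E₀)
    (hω : 0 ≤ ω) (hb : 0 ≤ b) (hbr : 0 ≤ b_r) (hρ : 0 ≤ ρ) (hρθ : ρ ≤ θ) (hνθ : ω + C_F * C_W < θ) (hθ1 : θ ≤ 1)
    (hc₀ : 0 ≤ c₀) (hconv : ∀ k, |S.β0 k - binf| ≤ c₀ * θ ^ k) :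
    NE4OnData D (2 * c₀ + shiftConst b b_r C_F C_r C_W E₀ ω θ) θ γ :=
  N17_of_split D S (hρ.trans hρθ) hθ1 hc₀ hconv
    (remainderShiftRate_of_model S M hRep hRead hT hA hAdm hS hCF hCr hCW hE₀ hω hb hbr hρ hρθ hνθ)

/-- **BOTH HALVES OF THE TITLE FROM ROWS NE2∕NE3's CURRENCIES (kernel, by name).**  «β⁰ conv»: if the datum's one-loop coefficients are
the second moments (1.22) of one-loop kernels through a dictionary `Dict : Beta.OneLoopDictionary d c S` and the kernels obey
`Beta.LimitRate.KernelInputs` — k-uniform decay (5.10) p. 293 + convergence WITH A GEOMETRIC RATE `K.θ` of the LINEAR theory (row NE2 =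
N15's subject, NOT PRINTED as a rate) —, then (AF-0r) holds at rate `K.θ` (`Beta.LimitRate.limitSplit_of_kernelInputs`), hence at any
`θ ≥ K.θ`; «β¹ shift + fading memory»: the one-step transfer model with its η-source (rows NE2∕NE3 through the step).  Conclusion
`NE4OnData D (2·K.c₀ + shiftConst …) θ γ` for every `θ ∈ [max(ρ, K.θ), 1]` above the window `ν`. [cite: Balaban1987RG1, (1.22) p.264 and (5.10) p.293] -/
theorem N17_of_kernelInputs_transferModel (D : FiniteEpsData F G) {d c : ℕ} (S : B12Beta.OneLoopSplit D.βfun)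
    (Dict : Beta.OneLoopDictionary d c S) (K : Beta.LimitRate.KernelInputs d Dict.limKernel) (M : StepTransferModel 𝔅 𝔸)
    {γ C_W ω C_F C_r E₀ b b_r ρ θ : ℝ} (hRep : M.Represents γ) (hRead : M.ReadsRemainder S γ)
    (hT : M.TransferBound C_W ω γ) (hA : M.ActivityLipschitz C_F C_r E₀ γ) (hAdm : M.Admissible E₀ γ)
    (hS : M.StepScaleShift b b_r ρ E₀ γ) (hCF : 0 ≤ C_F) (hCr : 0 ≤ C_r) (hCW : 0 ≤ C_W) (hE₀ : 0 ≤ E₀)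
    (hω : 0 ≤ ω) (hb : 0 ≤ b) (hbr : 0 ≤ b_r) (hρ : 0 ≤ ρ) (hρθ : ρ ≤ θ) (hνθ : ω + C_F * C_W < θ) (hKθ : K.θ ≤ θ)
    (hθ1 : θ ≤ 1) : NE4OnData D (2 * K.c₀ + shiftConst b b_r C_F C_r C_W E₀ ω θ) θ γ :=
  N17_of_transferModel D S M hRep hRead hT hA hAdm hS hCF hCr hCW hE₀ hω hb hbr hρ hρθ hνθ hθ1 K.c₀_nonneg
    fun k => (Beta.LimitRate.limitSplit_of_kernelInputs Dict K k).trans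
      (mul_le_mul_of_nonneg_left (pow_le_pow_left₀ K.θ_nonneg hKθ k) K.c₀_nonneg)

/-- **NODE U2's WHOLE INPUT TRIPLE ON THIS ROAD (kernel, by name)** — N17 ∧ `HistLipschitz` ∧ `FadingMemory` at the datum, at ONE rate:
with ALSO the coupling-Lipschitz leaf `CouplingLipschitz ℓ′ ℓ` ([I] p. 264, qualitative in print) and `ω > 0`,
`NE4TransferResolvent.ne4Triple_of_model` yields the history moduli `moduli ℓ ℓ′ C_r C_W ν` of `D.βfun` with fading memory at rate EXACTLY
`ν = ω + C_F·C_W`; worsening `ν ↦ θ` (`T4FlagMemory.fadingMemory_mono`) packages `Spine.NE4.U2Inputs D (2c₀ + shiftConst …)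
(ℓ + C_r·C_W·ℓ′∕ν) θ γ (moduli …)`.  On this road N22's statement (NE9 ∧ fading memory on U3's carriers) is NOT an in-edge: the
companions are DERIVED from the same leaves. [folklore] -/
theorem u2Inputs_of_transferModel (D : FiniteEpsData F G) (S : B12Beta.OneLoopSplit D.βfun) (M : StepTransferModel 𝔅 𝔸)
    {γ C_W ω C_F C_r ℓ' ℓ E₀ b b_r ρ θ binf c₀ : ℝ} (hRep : M.Represents γ) (hRead : M.ReadsRemainder S γ)
    (hT : M.TransferBound C_W ω γ) (hA : M.ActivityLipschitz C_F C_r E₀ γ) (hC : M.CouplingLipschitz ℓ' ℓ E₀ γ)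
    (hAdm : M.Admissible E₀ γ) (hS : M.StepScaleShift b b_r ρ E₀ γ)
    (hCF : 0 ≤ C_F) (hCr : 0 ≤ C_r) (hCW : 0 ≤ C_W) (hE₀ : 0 ≤ E₀) (hℓ : 0 ≤ ℓ) (hℓ' : 0 ≤ ℓ')
    (hω : 0 < ω) (hb : 0 ≤ b) (hbr : 0 ≤ b_r) (hρ : 0 ≤ ρ) (hρθ : ρ ≤ θ) (hνθ : ω + C_F * C_W < θ) (hθ1 : θ ≤ 1)
    (hc₀ : 0 ≤ c₀) (hconv : ∀ k, |S.β0 k - binf| ≤ c₀ * θ ^ k) :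
    U2Inputs D (2 * c₀ + shiftConst b b_r C_F C_r C_W E₀ ω θ) (ℓ + C_r * C_W * ℓ' / (ω + C_F * C_W)) θ γ
      (moduli ℓ ℓ' C_r C_W (ω + C_F * C_W)) := by
  obtain ⟨hSh, hL, hΛ⟩ := ne4Triple_of_model S M hRep hRead hT hA hC hAdm hS hCF hCr hCW hE₀ hℓ hℓ' hω hb hbr hρ
    hρθ hνθ hθ1 hc₀ hconv
  have hν : 0 < ω + C_F * C_W := by nlinarith [mul_nonneg hCF hCW]
  have hCΛ : 0 ≤ ℓ + C_r * C_W * ℓ' / (ω + C_F * C_W) := by positivity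
  exact ⟨hSh, hL, fadingMemory_mono hCΛ hν.le hνθ.le hΛ⟩

end Transfer

/-! ## §11 THE N17 → N27 EDGE ON THIS ROAD — no asymptotic-freedom binder: the memory GAP `ν < θ` replaces `EventualLowerH` -/

section GapEdge

/-- [bookkeeping] THE γ³-WINDOW HOLDS ON SMALL BOXES: `0 ≤ C`, `ν < θ`, `0 < θ < 1`, `0 < γ ≤ 1` and
`γ ≤ (1−θ)(θ−ν)∕(θ(C+1))` give `C·(γ³∕2)·θ∕(θ−ν) ≤ (1−θ)∕2` (`γ³ ≤ γ`).  Twin of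
`Spine.NE4.FadingFromRateRelAnalyticU2.relWindow_of_small_box` (there γ²). [folklore] -/
theorem gapWindow_of_small_box {C ν θ γ : ℝ} (hC : 0 ≤ C) (hνθ : ν < θ) (hθ0 : 0 < θ) (hθ1 : θ < 1)
    (hγ0 : 0 < γ) (hγ1 : γ ≤ 1) (hγW : γ ≤ (1 - θ) * (θ - ν) / (θ * (C + 1))) :
    C * (γ ^ 3 / 2) * (θ / (θ - ν)) ≤ (1 - θ) / 2 := by
  have hd : 0 < θ - ν := sub_pos.mpr hνθ
  have hC1 : 0 < C + 1 := by linarith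
  have hγ2 : γ ^ 2 ≤ 1 := by nlinarith
  have hγ3 : γ ^ 3 ≤ γ := by nlinarith
  have hW : γ * (θ * (C + 1)) ≤ (1 - θ) * (θ - ν) := (le_div_iff₀ (by positivity)).mp hγW
  have hq : 0 ≤ θ / (θ - ν) := div_nonneg hθ0.le hd.le
  have h1 : C * (γ ^ 3 / 2) * (θ / (θ - ν)) ≤ (C + 1) * (γ / 2) * (θ / (θ - ν)) := by
    have h1a : C * (γ ^ 3 / 2) ≤ C * (γ / 2) := mul_le_mul_of_nonneg_left (by linarith) hC
    have h1b : C * (γ / 2) ≤ (C + 1) * (γ / 2) := mul_le_mul_of_nonneg_right (by linarith) (by positivity)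
    exact mul_le_mul_of_nonneg_right (h1a.trans h1b) hq
  have h2 : (C + 1) * (γ / 2) * (θ / (θ - ν)) = γ * (θ * (C + 1)) / (2 * (θ - ν)) := by
    field_simp
  have h3 : γ * (θ * (C + 1)) / (2 * (θ - ν)) ≤ (1 - θ) * (θ - ν) / (2 * (θ - ν)) :=
    div_le_div_of_nonneg_right hW (by positivity)
  have h4 : (1 - θ) * (θ - ν) / (2 * (θ - ν)) = (1 - θ) / 2 := by
    field_simp
  calc C * (γ ^ 3 / 2) * (θ / (θ - ν)) ≤ (C + 1) * (γ / 2) * (θ / (θ - ν)) := h1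
    _ = γ * (θ * (C + 1)) / (2 * (θ - ν)) := h2
    _ ≤ (1 - θ) * (θ - ν) / (2 * (θ - ν)) := h3
    _ = (1 - θ) / 2 := h4

/-- **NODE U2's OUTPUT ON THE DATA ⇐ N17 + FADING HISTORY MODULI WITH A RATE GAP — NO `EventualLowerH` (kernel, by name).**  The AF-FREE
twin of `Spine.NE4.Targets.u2Output_of_u2Inputs`: `NE4OnData D c θ γ`, history moduli `HistLipschitz Λ γ D.βfun` with
`FadingMemory C ν Λ` at a memory rate `0 ≤ ν < θ < 1` (STRICTLY below the shift rate — exactly what §10's road delivers, `ν = ω + C_F·C_W`),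
the PRINTED-type upper bound `BetaUpperH β′ γ D.βfun` with `γ²β′ < 1` (only to run (0.20) forward, `T4TwoRunUniqueness.rgEqH_of_tuned`), a
bare sequence `g₀` TUNED to `g` within `]0,γ]` ([Balaban1987RG1] Thm 2's renormalization condition) and the γ³-window
`C·(γ³∕2)·θ∕(θ−ν) ≤ (1−θ)∕2` give `U2Output D g₀ (2c∕(1−θ)) θ` — `T4CurrencyMatching.injectedRate_of_runs_gap` at `g := runFlow D g₀`
(«the eventual lower bound is traded for the memory gap»).  NO `b`, NO `k₀`. [cite: Balaban1987RG1, (0.20) p.256 and Thm 2 p.259] -/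
theorem u2Output_of_N17_gap (D : FiniteEpsData F G) {c C θ ν γ β' g : ℝ} {Λ : ℕ → ℕ → ℝ} {g₀ : ℕ → ℝ}
    (hN : NE4OnData D c θ γ) (hL : HistLipschitz Λ γ D.βfun) (hΛ : FadingMemory C ν Λ)
    (hc : 0 ≤ c) (hC : 0 ≤ C) (hν0 : 0 ≤ ν) (hνθ : ν < θ) (hθ1 : θ < 1) (hγ : 0 < γ)
    (hhi : BetaUpperH β' γ D.βfun) (hγβ : γ ^ 2 * β' < 1) (ht : D.Tuned γ g g₀)
    (hsmall : C * (γ ^ 3 / 2) * (θ / (θ - ν)) ≤ (1 - θ) / 2) :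
    U2Output D g₀ (2 * c / (1 - θ)) θ := by
  have hθ0 : 0 < θ := lt_of_le_of_lt hν0 hνθ
  obtain ⟨hbox, hpin⟩ := box_and_pin_of_tuned D ht
  exact injectedRate_of_runs_gap (runFlow D g₀) g hθ0 hθ1 hθ0.le le_rfl hν0 hνθ hc hC hγ.le
    (fun K => rgEqH_of_tuned D hhi hγβ hγ le_rfl ht K) hbox hpin hN hL hΛ hsmall

/-- **THE SAME UNDER THE TARGETS' QUANTIFIER PREFIX, THE WINDOW DISCHARGED BY γ SMALL (kernel).**  With N17, the fading history moduli
(`ν < θ < 1`) and the printed-type upper bound given on ONE box `]0,γᵤ]`: node U2's output `U2Output D g₀ (2c∕(1−θ)) θ` for EVERY run box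
`γ ≤ γ₀ := min(γᵤ, 1, (1−θ)(θ−ν)∕(θ(C+1)))`, every `g`, every tuned `g₀` — the hypotheses restricted to the run box (`FlowStep.box_mono`), the
γ³-window by `gapWindow_of_small_box`.  AF-free twin of `Spine.NE4.Targets.u2Output_under` (there: `EventualLowerH b γᵤ k₀`, `b > 0`, and a
window binder).  `Hβ` and (B) are not used. [folklore] -/
theorem u2Output_under_of_N17_gap (D : FiniteEpsData F G) {Hβ : Prop} {c C θ ν γu β' : ℝ} {Λ : ℕ → ℕ → ℝ}
    (hN : NE4OnData D c θ γu) (hL : HistLipschitz Λ γu D.βfun) (hΛ : FadingMemory C ν Λ)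
    (hc : 0 ≤ c) (hC : 0 ≤ C) (hν0 : 0 ≤ ν) (hνθ : ν < θ) (hθ1 : θ < 1) (hγu : 0 < γu)
    (hhi : BetaUpperH β' γu D.βfun) (hγβ : γu ^ 2 * β' < 1) :
    D.UnderHypotheses Hβ fun g₀ => U2Output D g₀ (2 * c / (1 - θ)) θ := by
  intro _ _
  have hθ0 : 0 < θ := lt_of_le_of_lt hν0 hνθ
  have hWpos : 0 < (1 - θ) * (θ - ν) / (θ * (C + 1)) :=
    div_pos (mul_pos (by linarith) (by linarith)) (mul_pos hθ0 (by linarith))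
  refine ⟨min γu (min 1 ((1 - θ) * (θ - ν) / (θ * (C + 1)))), lt_min hγu (lt_min one_pos hWpos),
    fun γ hγ hγle => ⟨1, one_pos, fun g _ _ g₀ ht => ?_⟩⟩
  have hγu' : γ ≤ γu := hγle.trans (min_le_left _ _)
  have hγ1 : γ ≤ 1 := hγle.trans ((min_le_right _ _).trans (min_le_left _ _))
  have hγW : γ ≤ (1 - θ) * (θ - ν) / (θ * (C + 1)) := hγle.trans ((min_le_right _ _).trans (min_le_right _ _))
  have hγβ' : γ ^ 2 * β' < 1 := by
    rcases le_or_gt β' 0 with hb | hb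
    · exact lt_of_le_of_lt (mul_nonpos_of_nonneg_of_nonpos (sq_nonneg γ) hb) one_pos
    · exact lt_of_le_of_lt (mul_le_mul_of_nonneg_right (pow_le_pow_left₀ hγ.le hγu' 2) hb.le) hγβ
  exact u2Output_of_N17_gap D (fun k w hw => hN k w (box_mono hγu' (k + 1) hw))
    (fun k p q hp hq => hL k p q (box_mono hγu' k hp) (box_mono hγu' k hq)) hΛ hc hC hν0 hνθ hθ1 hγ
    (fun k v hv => hhi k v (box_mono hγu' k hv)) hγβ' ht (gapWindow_of_small_box hC hνθ hθ0 hθ1 hγ hγ1 hγW)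

/-- **N17 → N27 END TO END ON THE ONE-STEP ROAD (kernel, by name)** — node U2's output under the targets' prefix,
`D.UnderHypotheses Hβ (fun g₀ ↦ U2Output D g₀ (2(2c₀ + shiftConst …)∕(1−θ)) θ)` (node U6's ∕ N27's input), from: the one-step transfer
model's leaves on `]0,γ]` (NE2∕NE3 inside `StepScaleShift`, (B) inside `Admissible`), (AF-0r) `hconv`, and the PRINTED-type upper bound (U)
`BetaUpperH β′ γ` with `γ²β′ < 1` — NOTHING ELSE: NO N18, NO N22, NO (D4) read-out binder, NO `EventualLowerH`, NO window binder (the memory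
gap `ν = ω + C_F·C_W < θ` of §10 is free on this road; `u2Inputs`-triple by `ne4Triple_of_model`, then `u2Output_under_of_N17_gap`).
Compare file 1 `u2Output_under_of_u3edge` ∕ file 2 `u2Output_under_of_u3edge_limitForm` (road U3 at output rate = input rate, AF binder
at strict grade) and `u2Output_under_of_u3edge_gap` below (road U3 with rate loss, AF-free).  Every leaf a BINDER; NE4 NOT thereby proved
for Bałaban's β. [cite: Balaban1987RG1, Thm 2 p.259 and (0.20) p.256] -/
theorem u2Output_under_of_transferModel (D : FiniteEpsData F G) (S : B12Beta.OneLoopSplit D.βfun)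
    (M : StepTransferModel 𝔅 𝔸) {Hβ : Prop} {γ C_W ω C_F C_r ℓ' ℓ E₀ b b_r ρ θ binf c₀ β' : ℝ}
    (hRep : M.Represents γ) (hRead : M.ReadsRemainder S γ)
    (hT : M.TransferBound C_W ω γ) (hA : M.ActivityLipschitz C_F C_r E₀ γ) (hC : M.CouplingLipschitz ℓ' ℓ E₀ γ)
    (hAdm : M.Admissible E₀ γ) (hS : M.StepScaleShift b b_r ρ E₀ γ)
    (hCF : 0 ≤ C_F) (hCr : 0 ≤ C_r) (hCW : 0 ≤ C_W) (hE₀ : 0 ≤ E₀) (hℓ : 0 ≤ ℓ) (hℓ' : 0 ≤ ℓ')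
    (hω : 0 < ω) (hb : 0 ≤ b) (hbr : 0 ≤ b_r) (hρ : 0 ≤ ρ) (hρθ : ρ ≤ θ) (hνθ : ω + C_F * C_W < θ) (hθ1 : θ < 1)
    (hc₀ : 0 ≤ c₀) (hconv : ∀ k, |S.β0 k - binf| ≤ c₀ * θ ^ k)
    (hγ : 0 < γ) (hhi : BetaUpperH β' γ D.βfun) (hγβ : γ ^ 2 * β' < 1) :
    D.UnderHypotheses Hβ fun g₀ =>
      U2Output D g₀ (2 * (2 * c₀ + shiftConst b b_r C_F C_r C_W E₀ ω θ) / (1 - θ)) θ := by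
  obtain ⟨hSh, hL, hΛ⟩ := ne4Triple_of_model S M hRep hRead hT hA hC hAdm hS hCF hCr hCW hE₀ hℓ hℓ' hω hb hbr hρ
    hρθ hνθ hθ1.le hc₀ hconv
  have hν0 : 0 < ω + C_F * C_W := by nlinarith [mul_nonneg hCF hCW]
  have hc : 0 ≤ 2 * c₀ + shiftConst b b_r C_F C_r C_W E₀ ω θ := by
    have h0 := shiftConst_nonneg hb hbr hCF hCr hCW hE₀ hνθ
    linarith
  have hCΛ : 0 ≤ ℓ + C_r * C_W * ℓ' / (ω + C_F * C_W) := by positivity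
  exact u2Output_under_of_N17_gap D hSh hL hΛ hc hCΛ hν0.le hνθ hθ1 hγ hhi hγβ

/-- **CENSUS CONSEQUENCE FOR EVERY ROAD: NODE U2's INPUT TRIPLE AT ONE RATE ⇒ ITS OUTPUT AT ANY STRICTLY WORSE RATE, AF-FREE (kernel).**
`Spine.NE4.U2Inputs D c C ρ γᵤ Λ` (N17 + history moduli + fading memory, ONE joint rate `ρ` — e.g. file 1's `u2Inputs_of_u3edge` from
(D4) ∧ N18 ∧ N22), the PRINTED-type upper bound `BetaUpperH β′ γᵤ` with `γᵤ²β′ < 1`, and ANY `ρ′ ∈ ]ρ, 1[` give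
`D.UnderHypotheses Hβ (fun g₀ ↦ U2Output D g₀ (2c∕(1−ρ′)) ρ′)` — N17 worsened to rate `ρ′` (file 1 `N17_mono`), memory rate `ρ < ρ′` is the gap,
then `u2Output_under_of_N17_gap`.  NO `EventualLowerH`, NO `b`, NO `k₀`, NO window binder: compare `Spine.NE4.Targets.u2Output_under`
(output rate = `ρ`, AF binder at strict grade + window).  The price is the rate loss `ρ ↦ ρ′` only. [folklore] -/
theorem u2Output_under_of_u2Inputs_gap (D : FiniteEpsData F G) {Hβ : Prop} {c C ρ ρ' γu β' : ℝ} {Λ : ℕ → ℕ → ℝ}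
    (hI : U2Inputs D c C ρ γu Λ) (hc : 0 ≤ c) (hC : 0 ≤ C) (hρ0 : 0 ≤ ρ) (hρρ' : ρ < ρ') (hρ'1 : ρ' < 1)
    (hγu : 0 < γu) (hhi : BetaUpperH β' γu D.βfun) (hγβ : γu ^ 2 * β' < 1) :
    D.UnderHypotheses Hβ fun g₀ => U2Output D g₀ (2 * c / (1 - ρ')) ρ' :=
  u2Output_under_of_N17_gap D (N17_mono D hI.1 le_rfl hc le_rfl hρ0 hρρ'.le) hI.2.1 hI.2.2 hc hC hρ0 hρρ' hρ'1 hγu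
    hhi hγβ

/-- **ROAD U3 WITH RATE LOSS — THE N17 → N27 EDGE FROM (D4) ∧ N18 ∧ N22 WITHOUT THE ASYMPTOTIC-FREEDOM BINDER (kernel, by name).**
File 1's glue in-edge list on the `γ`-boxes (`u2Inputs_of_u3edge`: the (D4) read-out binders, N18 = NE5 b-family, N22 = NE9 ∧ fading memory,
the `cr`-bounded covariant read-out, letter signs, joint rate `ρ ≥ max θ ω`) + the PRINTED-type upper bound `BetaUpperH β′ γ` with `γ²β′ < 1` +
ANY output rate `ρ′ ∈ ]ρ,1[`: `D.UnderHypotheses Hβ (fun g₀ ↦ U2Output D g₀ (2(cr·C₅·θ)∕(1−ρ′)) ρ′)`.  Compare file 1 `u2Output_under_of_u3edge`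
(binders `EventualLowerH b γ k₀`, `b > 0`, window `cr·C₉·ω·((k₀+1)γ³ + 2γ∕b) ≤ (1−ρ)∕2`) and file 2 §7 (those binders supplied by
`Beta.Assembly.LimitForm`): here NEITHER is needed.  Every U3 input a BINDER (rows NE5, NE9, (R) UNPRINTED). [cite: Balaban1987RG1, Thm 2 p.259 and (0.20) p.256] -/
theorem u2Output_under_of_u3edge_gap (D : FiniteEpsData F G) {Hβ : Prop} {C : T4OutputRate.Carriers} {W : Set (ℕ → ℝ)}
    {EA : T4OutputRate.Functional C C.BgA} {EB : ℝ → T4OutputRate.Functional C C.BgB}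
    {𝒜A : Set (T4BetaReadOut.Slice C C.BgA)} {𝒜B : Set (T4BetaReadOut.Slice C C.BgB)}
    {rA : T4BetaReadOut.ReadOut C C.BgA} {rB : T4BetaReadOut.ReadOut C C.BgB}
    {γ κ θ C₅ C₉ ω cr ρ ρ' β' : ℝ} {Λ : ℕ → ℕ → ℝ}
    (hW : ∀ k (v : Fin (k + 1) → ℝ), v ∈ Box γ k → T4FlagMemory.extd v ∈ W)
    (h18 : ∀ b, 0 < b → b ≤ γ → T4OutputRate.NE5 EA (EB b) W κ θ C₅)
    (h22 : T4OutputRate.NE9 EA W κ Λ ∧ T4OutputRate.FadingMemory C₉ ω Λ)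
    (hA : T4BetaReadOut.RepresentsA EA rA γ D.βfun) (hB : T4BetaReadOut.RepresentsB EB rB γ D.βfun)
    (h𝒜A : ∀ g ∈ W, EA g ∈ 𝒜A) (h𝒜B : ∀ b, 0 < b → b ≤ γ → ∀ g ∈ W, EB b g ∈ 𝒜B)
    (hr : T4BetaReadOutLipschitz.ReadBoundedOn 𝒜A rA κ cr) (hcov : T4BetaReadOutLipschitz.ReadCovariantOn 𝒜A 𝒜B rA rB κ cr)
    (hcr : 0 ≤ cr) (hC₅ : 0 ≤ C₅) (hθ : 0 ≤ θ) (hω : 0 ≤ ω) (hθρ : θ ≤ ρ) (hωρ : ω ≤ ρ) (hρρ' : ρ < ρ') (hρ'1 : ρ' < 1)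
    (hγ : 0 < γ) (hhi : BetaUpperH β' γ D.βfun) (hγβ : γ ^ 2 * β' < 1) :
    D.UnderHypotheses Hβ fun g₀ => U2Output D g₀ (2 * (cr * C₅ * θ) / (1 - ρ')) ρ' :=
  have hC₉ : 0 ≤ C₉ := T4BetaReadOut.fadingMemory_const_nonneg h22.2
  u2Output_under_of_u2Inputs_gap D (u2Inputs_of_u3edge D hW h18 h22 hA hB h𝒜A h𝒜B hr hcov hcr hC₅ hθ hω hθρ hωρ)
    (mul_nonneg (mul_nonneg hcr hC₅) hθ) (mul_nonneg (mul_nonneg hcr hC₉) hω) (hθ.trans hθρ) hρρ' hρ'1 hγ hhi hγβ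

end GapEdge

/-! ## §12 NON-VACUITY AND CONTRAST — the road's antecedent is inhabited by a HISTORY-DEPENDENT family (the tree's toy) -/

section Witness

/-- **N17 IS MET, NON-VACUOUSLY, AT ANY DATUM CARRYING THE TREE's TOY β (kernel, by name).**  For the toy of
`Support/NE4TransferResolventWitness` (`𝔅 = 𝔸 = ℝ`; linear age-weighted transfer with `C_W = 1`, age factor `ω`, Lipschitz step `C_F = ε`,
η-source `s(1−ρ)ρ^k`, printed split with vanishing β¹ at `g_k = 0`): at any datum whose β-family IS `toyBeta ω ε s ρ binf c₀ θ` —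
a genuinely HISTORY-DEPENDENT family (`toyBeta_depends_on_history`) whose memory rate `ν = ω + ε` is ATTAINED (`toy_not_fadingMemory_below`)
— N17 HOLDS with some constant at every rate `θ ∈ ]ν, 1]`, `θ ≥ ρ` (`toy_ne4Triple` = §10's road applied to the toy).  CONTRAST file 1 §6
`not_N17_of_oscillating`: the history-FREE oscillating family violates N17 at every `θ < 1`.  A toy — NOT Bałaban's β, NOT NE4. [folklore] -/
theorem N17_of_toyBeta (D : FiniteEpsData F G) {ω ε s ρ binf c₀ θ γ : ℝ}
    (hD : D.βfun = toyBeta ω ε s ρ binf c₀ θ) (hω : 0 < ω) (hε : 0 < ε) (hνθ : ω + ε < θ) (hθ1 : θ ≤ 1)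
    (hρ : 0 ≤ ρ) (hρθ : ρ ≤ θ) (hs : 0 ≤ s) (hγ : 0 < γ) (hc₀ : 0 ≤ c₀) : ∃ c, NE4OnData D c θ γ := by
  obtain ⟨c, _, _, h, _, _⟩ := toy_ne4Triple (binf := binf) hω hε hνθ hθ1 hρ hρθ hs hγ hc₀
  refine ⟨c, ?_⟩
  unfold NE4OnData
  rw [hD]
  exact h

end Witness

end Summit.QuantumFields.YangMills.Theorems.BalabanUVNodesN17

end
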